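import Summits.CriticalPhenomena.PercolationContinuityZ3.Theorems.PercNearOneGluingNoHeavyLowerTailQ44ComplementaryPacking
import Mathlib.Combinatorics.SetFamily.FourFunctions
import HarnessLib

/-!
# The bipolar Marica–Schönheim count (the two-part case of the polar lemma) and its cell kernels

Support file for crux `stmt-CriticalPhenomena-4575` (master-family programme; packing `U` / darts-only `D_U` / Conjecture W
line of `prim-bnk-1`), seat `prim-bnk-1` gen 36; memo `run/shared/lean/prim/prim-l12/FROM-prim-bnk-1-gen36-POLAR-LEMMA.md` §2.

Setting (memo §2).  For a down-set `D` and an up-set `T` of subsets of a finite set `E` the middle region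
`R = 2^E ∖ (D ∪ T)` splits into connected components of its comparability graph; the memo's POLAR LEMMA (conjecture,
exhaustive for `|E| ≤ 5`) says that the number of antipodal pairs `{S, Sᶜ} ⊆ R` lying in different components is at most
the number of polar pairs `{S, Sᶜ}` with `S ∈ D`, `Sᶜ ∈ T`.  It contains the three-point inequality
`P(ab|c)P(ac|b) + P(ab|c)P(bc|a) + P(ac|b)P(bc|a) ≤ P(a|b|c)P(abc)` and is the `C6` sibling of the `C8` lemma behind `D_U`.

This file PROVES the two-part case, in a hypothesis-light abstract form:

* `PolarMS.card_cross_le_card_polar` (**bipolar Marica–Schönheim**): if `A, B` are disjoint families such that every subset of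
  a member of `A` lies in `D ∪ A`, every superset in `T ∪ A`, and likewise for `B`, then
  `#{S ∈ A : Sᶜ ∈ B} ≤ #{S ∈ D : Sᶜ ∈ T}`.  Proof: all pairwise differences of the family `{S ∈ A : Sᶜ ∈ B}` lie in
  `{S ∈ D : Sᶜ ∈ T}`, and Marica–Schönheim (`Finset.card_le_card_diffs`).
* `PolarMS.card_cross_le_card_polar_cells`: the same along a monotone four-point cell map `ι` for any "cut" `(L, U, A, B)` of the
  cell order `TwoCopyMono.ple` (every cell below a cell of `A` is in `L ∪ A`, every cell above in `U ∪ A`, same for `B`,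
  `A ∩ B = ∅`): `#{S : ι S ∈ A, ι Sᶜ ∈ B} ≤ #{S : ι S ∈ L, ι Sᶜ ∈ U}`.
* `PolarMS.goodKernel_cut`: the kernel `[i ∈ L][j ∈ U] − [i ∈ A][j ∈ B]` (written `indK (L ×ˢ U) − indK (A ×ˢ B)`) is a
  `TwoCopyMono.GoodKernel` for every such cut, and `PolarMS.sum_cells_le_of_cut` is the law-level form
  `Σ_{a∈A,b∈B} c_a c_b ≤ Σ_{l∈L,u∈U} c_l c_u` on every finite weighted graph (at law level this is an Ahlswede–Daykin instance;
  the fibre count is the new statement).  A cut is passed as five hypotheses (`A ∩ B = ∅` and the four closure tables), no new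
  definitions.
* `PolarMS.crossing_vs_pairing_le`: the instance (cut checked by `decide`) `L = {a|b|c|y}`, `U = {three-blocks, abcy}`, `A = {by, ac, ac|by, bc, ay, ay|bc}`,
  `B = {cy, ab, ab|cy}` (the three components of the middle of this cut are the three perfect matchings).

Pure finite combinatorics + table facts by `decide`; no definitions, no sorries, no named facts, standard axioms.
-/

namespace Summit.CriticalPhenomena.PercolationContinuityZ3.Theorems

namespace PolarMS

open Finset
open scoped FinsetFamily

section Abstract

variable {α : Type*} [DecidableEq α] [Fintype α]

/-- **Bipolar Marica–Schönheim.**  Let `A, B` be disjoint families of subsets of a finite type such that every subset of a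
member of `A` lies in `D ∪ A` and every superset in `T ∪ A`, and likewise for `B`.  Then the number of `S ∈ A` with
`Sᶜ ∈ B` is at most the number of `S ∈ D` with `Sᶜ ∈ T`. [this work] -/
theorem card_cross_le_card_polar (D T A B : Finset (Finset α)) (hAB : Disjoint A B)
    (hDA : ∀ S ∈ A, ∀ Z : Finset α, Z ⊆ S → Z ∈ D ∨ Z ∈ A)
    (hDB : ∀ S ∈ B, ∀ Z : Finset α, Z ⊆ S → Z ∈ D ∨ Z ∈ B)
    (hTA : ∀ S ∈ A, ∀ Z : Finset α, S ⊆ Z → Z ∈ T ∨ Z ∈ A)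
    (hTB : ∀ S ∈ B, ∀ Z : Finset α, S ⊆ Z → Z ∈ T ∨ Z ∈ B) :
    #(A.filter fun S => Sᶜ ∈ B) ≤ #(D.filter fun S => Sᶜ ∈ T) := by
  set 𝒮 : Finset (Finset α) := A.filter fun S => Sᶜ ∈ B with h𝒮
  have hsub : 𝒮 \\ 𝒮 ⊆ D.filter fun S => Sᶜ ∈ T := by
    intro Z hZ
    rw [mem_diffs] at hZ
    obtain ⟨S, hS, S', hS', rfl⟩ := hZ
    rw [h𝒮, mem_filter] at hS hS'
    rw [mem_filter]
    refine ⟨?_, ?_⟩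
    · -- `S \ S' ⊆ S ∈ A` and `S \ S' ⊆ S'ᶜ ∈ B`
      have h1 := hDA S hS.1 (S \ S') sdiff_subset
      have h2 := hDB S'ᶜ hS'.2 (S \ S') (by
        intro x hx
        rw [mem_compl]
        exact (mem_sdiff.1 hx).2)
      rcases h1 with h1 | h1
      · exact h1
      rcases h2 with h2 | h2
      · exact h2
      exact ((disjoint_left.1 hAB) h1 h2).elim
    · -- `(S \ S')ᶜ ⊇ S' ∈ A` and `(S \ S')ᶜ ⊇ Sᶜ ∈ B`
      have hsup1 : S' ⊆ (S \ S')ᶜ := by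
        intro x hx
        rw [mem_compl, mem_sdiff, not_and, not_not]
        exact fun _ => hx
      have hsup2 : Sᶜ ⊆ (S \ S')ᶜ := by
        intro x hx
        rw [mem_compl] at hx
        rw [mem_compl, mem_sdiff, not_and]
        exact fun h => (hx h).elim
      have h1 := hTA S' hS'.1 (S \ S')ᶜ hsup1
      have h2 := hTB Sᶜ hS.2 (S \ S')ᶜ hsup2
      rcases h1 with h1 | h1
      · exact h1
      rcases h2 with h2 | h2
      · exact h2
      exact ((disjoint_left.1 hAB) h1 h2).elim
  calc #𝒮 ≤ #(𝒮 \\ 𝒮) := 𝒮.card_le_card_diffs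
    _ ≤ #(D.filter fun S => Sᶜ ∈ T) := card_le_card hsub

end Abstract

/-! ## Along a monotone four-point cell map -/

open TwoCopyMono FourPointAtoms

/-! A CUT of the cell order is given by four cell sets `L U A B` with `A ∩ B = ∅` such that every cell below a cell of `A`
lies in `L ∪ A`, every cell above in `U ∪ A`, and likewise for `B` (so `A` and `B` are unions of comparability components of
the cells outside `L ∪ U` when `L` is a down-set and `U` an up-set); it is passed as the five hypotheses `hAB hLA hLB hUA hUB`. -/

/-- **The bipolar count along a monotone cell map**: for a cut `(L, U, A, B)`,
`#{S : ι S ∈ A, ι Sᶜ ∈ B} ≤ #{S : ι S ∈ L, ι Sᶜ ∈ U}`. [this work] -/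
theorem card_cross_le_card_polar_cells {γ : Type*} [Fintype γ] [DecidableEq γ] (ι : Finset γ → Fin 15)
    (hmono : ∀ X Y : Finset γ, X ⊆ Y → ple (ι X) (ι Y) = true) {L U A B : Finset (Fin 15)} (hAB : Disjoint A B)
    (hLA : ∀ a ∈ A, ∀ x : Fin 15, ple x a = true → x ∈ L ∨ x ∈ A) (hLB : ∀ b ∈ B, ∀ x : Fin 15, ple x b = true → x ∈ L ∨ x ∈ B)
    (hUA : ∀ a ∈ A, ∀ x : Fin 15, ple a x = true → x ∈ U ∨ x ∈ A) (hUB : ∀ b ∈ B, ∀ x : Fin 15, ple b x = true → x ∈ U ∨ x ∈ B) :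
    #(Finset.univ.filter fun S : Finset γ => ι S ∈ A ∧ ι Sᶜ ∈ B) ≤
      #(Finset.univ.filter fun S : Finset γ => ι S ∈ L ∧ ι Sᶜ ∈ U) := by
  classical
  have key := card_cross_le_card_polar (Finset.univ.filter fun S : Finset γ => ι S ∈ L)
    (Finset.univ.filter fun S : Finset γ => ι S ∈ U) (Finset.univ.filter fun S : Finset γ => ι S ∈ A)
    (Finset.univ.filter fun S : Finset γ => ι S ∈ B) ?_ ?_ ?_ ?_ ?_
  · have e1 : ((Finset.univ.filter fun S : Finset γ => ι S ∈ A).filter fun S => Sᶜ ∈ Finset.univ.filter fun S : Finset γ => ι S ∈ B)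
        = Finset.univ.filter fun S : Finset γ => ι S ∈ A ∧ ι Sᶜ ∈ B := by
      ext S; simp only [mem_filter, mem_univ, true_and]
    have e2 : ((Finset.univ.filter fun S : Finset γ => ι S ∈ L).filter fun S => Sᶜ ∈ Finset.univ.filter fun S : Finset γ => ι S ∈ U)
        = Finset.univ.filter fun S : Finset γ => ι S ∈ L ∧ ι Sᶜ ∈ U := by
      ext S; simp only [mem_filter, mem_univ, true_and]
    rw [e1, e2] at key
    exact key
  · rw [disjoint_left]
    intro S hSA hSB
    rw [mem_filter] at hSA hSB
    exact (disjoint_left.1 hAB) hSA.2 hSB.2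
  · intro S hS Z hZS
    rw [mem_filter] at hS
    simp only [mem_filter, mem_univ, true_and]
    exact hLA _ hS.2 _ (hmono Z S hZS)
  · intro S hS Z hZS
    rw [mem_filter] at hS
    simp only [mem_filter, mem_univ, true_and]
    exact hLB _ hS.2 _ (hmono Z S hZS)
  · intro S hS Z hSZ
    rw [mem_filter] at hS
    simp only [mem_filter, mem_univ, true_and]
    exact hUA _ hS.2 _ (hmono S Z hSZ)
  · intro S hS Z hSZ
    rw [mem_filter] at hS
    simp only [mem_filter, mem_univ, true_and]
    exact hUB _ hS.2 _ (hmono S Z hSZ)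

/-! ## The cell kernels of cuts are good -/

/-! The kernel of a cut is `fun i j => indK (L ×ˢ U) i j - indK (A ×ˢ B) i j` = `[i ∈ L][j ∈ U] − [i ∈ A][j ∈ B]`. -/

/-- The antipodal sum of the cut kernel along a cell map, in point counts. [this work] -/
theorem sum_kerCut_map {γ : Type*} [Fintype γ] [DecidableEq γ] (L U A B : Finset (Fin 15)) (ι : Finset γ → Fin 15) :
    (∑ T : Finset γ, (indK (L ×ˢ U) (ι T) (ι Tᶜ) - indK (A ×ˢ B) (ι T) (ι Tᶜ))) =
      (#(Finset.univ.filter fun S : Finset γ => ι S ∈ L ∧ ι Sᶜ ∈ U) : ℤ) -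
        (#(Finset.univ.filter fun S : Finset γ => ι S ∈ A ∧ ι Sᶜ ∈ B) : ℤ) := by
  rw [Finset.sum_sub_distrib, sum_indK_map, sum_indK_map]
  have e1 : (Finset.univ.filter fun T : Finset γ => (ι T, ι Tᶜ) ∈ L ×ˢ U) =
      Finset.univ.filter fun S : Finset γ => ι S ∈ L ∧ ι Sᶜ ∈ U := by
    ext S; simp only [mem_filter, mem_univ, true_and, mem_product]
  have e2 : (Finset.univ.filter fun T : Finset γ => (ι T, ι Tᶜ) ∈ A ×ˢ B) =
      Finset.univ.filter fun S : Finset γ => ι S ∈ A ∧ ι Sᶜ ∈ B := by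
    ext S; simp only [mem_filter, mem_univ, true_and, mem_product]
  rw [e1, e2]

/-- **Cut kernels are good**: `[i ∈ L][j ∈ U] − [i ∈ A][j ∈ B]` is a `GoodKernel` for every cut. [this work] -/
theorem goodKernel_cut {L U A B : Finset (Fin 15)} (hAB : Disjoint A B)
    (hLA : ∀ a ∈ A, ∀ x : Fin 15, ple x a = true → x ∈ L ∨ x ∈ A) (hLB : ∀ b ∈ B, ∀ x : Fin 15, ple x b = true → x ∈ L ∨ x ∈ B)
    (hUA : ∀ a ∈ A, ∀ x : Fin 15, ple a x = true → x ∈ U ∨ x ∈ A) (hUB : ∀ b ∈ B, ∀ x : Fin 15, ple b x = true → x ∈ U ∨ x ∈ B) :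
    GoodKernel (fun i j => indK (L ×ˢ U) i j - indK (A ×ˢ B) i j) := by
  classical
  refine ⟨fun γ _ _ P hmono heqv => ?_⟩
  have hex : ∀ T : Finset γ, ∃ i : Fin 15, P T = pp i := fun T => exists_pat_of_isEqv (heqv T)
  choose ι hι using hex
  have hle : ∀ X Y : Finset γ, X ⊆ Y → ple (ι X) (ι Y) = true := by
    intro X Y hXY
    apply ple_of_profLE
    rw [← hι X, ← hι Y]
    exact hmono X Y hXY
  have hc := card_cross_le_card_polar_cells ι hle hAB hLA hLB hUA hUB
  have hP : (∑ T : Finset γ, liftK (fun i j => indK (L ×ˢ U) i j - indK (A ×ˢ B) i j) (P T) (P Tᶜ)) =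
      ∑ T : Finset γ, (indK (L ×ˢ U) (ι T) (ι Tᶜ) - indK (A ×ˢ B) (ι T) (ι Tᶜ)) := by
    refine Finset.sum_congr rfl fun T _ => ?_
    rw [hι T, hι Tᶜ, liftK_pp]
  rw [hP, sum_kerCut_map]
  have : (#(Finset.univ.filter fun S : Finset γ => ι S ∈ A ∧ ι Sᶜ ∈ B) : ℤ) ≤
      (#(Finset.univ.filter fun S : Finset γ => ι S ∈ L ∧ ι Sᶜ ∈ U) : ℤ) := by exact_mod_cast hc
  linarith

/-! ## Law level -/

variable {n : ℕ}

/-- Evaluation of the cut kernel on a cell vector. [this work] -/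
theorem sum_kerCut_cell (L U A B : Finset (Fin 15)) (c : Fin 15 → ℝ) :
    (∑ i : Fin 15, ∑ j : Fin 15, ((indK (L ×ˢ U) i j - indK (A ×ˢ B) i j : ℤ) : ℝ) * c i * c j) =
      (∑ p ∈ L ×ˢ U, c p.1 * c p.2) - ∑ p ∈ A ×ˢ B, c p.1 * c p.2 := by
  have hsplit : ∀ i j : Fin 15, ((indK (L ×ˢ U) i j - indK (A ×ˢ B) i j : ℤ) : ℝ) * c i * c j =
      (indK (L ×ˢ U) i j : ℝ) * c i * c j - (indK (A ×ˢ B) i j : ℝ) * c i * c j := by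
    intro i j; push_cast; ring
  simp_rw [hsplit, Finset.sum_sub_distrib]
  rw [sum_indK_cell, sum_indK_cell]

/-- **Law-level bipolar inequality**: for every cut `(L, U, A, B)` of the cell order, every finite weighted graph and all marked
points, `Σ_{a ∈ A, b ∈ B} c_a c_b ≤ Σ_{l ∈ L, u ∈ U} c_l c_u`. [this work] -/
theorem sum_cells_le_of_cut {L U A B : Finset (Fin 15)} (hAB : Disjoint A B)
    (hLA : ∀ a ∈ A, ∀ x : Fin 15, ple x a = true → x ∈ L ∨ x ∈ A) (hLB : ∀ b ∈ B, ∀ x : Fin 15, ple x b = true → x ∈ L ∨ x ∈ B)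
    (hUA : ∀ a ∈ A, ∀ x : Fin 15, ple a x = true → x ∈ U ∨ x ∈ A) (hUB : ∀ b ∈ B, ∀ x : Fin 15, ple b x = true → x ∈ U ∨ x ∈ B)
    (w : Sym2 (Fin n) → unitInterval) (a b c y : Fin n) :
    (∑ p ∈ A ×ˢ B, cell w a b c y p.1 * cell w a b c y p.2) ≤ ∑ p ∈ L ×ˢ U, cell w a b c y p.1 * cell w a b c y p.2 := by
  have h0 := sum_kernel_cell_nonneg (goodKernel_cut hAB hLA hLB hUA hUB) w a b c y
  rw [sum_kerCut_cell] at h0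
  linarith

/-! ## An instance: crossing structure against the pairing `ab|cy` -/

/-- **Crossing against pairing**: on every finite weighted graph and all marked points `a b c y`,
`(c₂+c₅+c₉+c₃+c₄+c₈)·(c₁+c₆+c₁₁) ≤ c₀·(c₇+c₁₀+c₁₂+c₁₃+c₁₄)` in the cells of `FourPointAtoms.pat4` — in words: the
probability that copy 1 joins marked points only along crossing pairs (one crossing pair, or both pairs of a crossing matching)
while copy 2 joins only along the pairing `ab|cy` is at most the probability that copy 1 joins nothing while copy 2 has a
three-block or joins everything. [this work] -/
theorem crossing_vs_pairing_le (w : Sym2 (Fin n) → unitInterval) (a b c y : Fin n) :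
    (∑ p ∈ ({2, 5, 9, 3, 4, 8} : Finset (Fin 15)) ×ˢ ({1, 6, 11} : Finset (Fin 15)), cell w a b c y p.1 * cell w a b c y p.2) ≤
      ∑ p ∈ ({0} : Finset (Fin 15)) ×ˢ ({7, 10, 12, 13, 14} : Finset (Fin 15)), cell w a b c y p.1 * cell w a b c y p.2 :=
  sum_cells_le_of_cut (by decide) (by decide) (by decide) (by decide) (by decide) w a b c y

end PolarMS

end Summit.CriticalPhenomena.PercolationContinuityZ3.Theorems
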